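import Literature.NumberTheory.EllipticCurves.DivisionPolynomialTorsion
import Literature.NumberTheory.EllipticCurves.VeluOddKernelProofs
import Mathlib.AlgebraicGeometry.EllipticCurve.DivisionPolynomial.Degree
import HarnessLib

/-!
# Pair values of a basis of `E[3]`: the three cube roots of `Δ`
# (cell `b2b-bsdres`, team n1011, seat p02 gen 10 — row T-E3SYMP, file F1; TOOL, pure algebra)

HONEST FRAMING (cell `b2b-bsdres`, run/shared/lean/b2b/bsd-rank1-residual/, verbatim in every
file): the goal of the cell is to DELETE the COMBINATION-SHAPED residual classes of the
Birch–Swinnerton-Dyer formula for ALL analytic-rank `≤ 1` elliptic curves over `ℚ` — "full BSD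
formula for every rank `≤ 1` curve in class `C`" assembled STRICTLY from published theorems — so
that the rank-`≤ 1` remainder becomes exactly the CONSTRUCTION-SHAPED classes, which are TYPED
(missing-input `Prop`s), NOT attempted. This is not "finishing BSD". Team n1011 (N10 / N11):
research route; no claim beyond the stated classes; labels UNCHANGED; nothing is booked. Theorems
only (no definition, no named fact).

## What this file proves

Let `W` be an elliptic curve over a field `F` of characteristic `0` (ANY Weierstrass model) and let
`S, T ∈ W(F)` be a BASIS of the `3`-torsion seen inside `W(F)`: `3S = 3T = O` and the four points
`S, T, S + T, S − T` are all `≠ O`.  Write `a, b, c, d` for the abscissae of `S, T, S + T, S − T`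
(the tree's `WeierstrassCurve.Affine.Point.xOf`) and

  `B₁ := b₄ − 3(ab + cd)`,  `B₂ := b₄ − 3(ac + bd)`,  `B₃ := b₄ − 3(ad + bc)`

(the three PAIR VALUES of the basis, one for each pairing of `⟨S⟩, ⟨T⟩, ⟨S + T⟩, ⟨S − T⟩`):
* `Ψ₃_eq_prod_of_basis` — `Ψ₃ = 3 (X − a)(X − b)(X − c)(X − d)` (*AEC* Ex. 3.7, tree
  `three_smul_some_eq_zero_iff`); `vieta_of_basis` — `b₂ = −3 Σ a`, `b₄ = Σ ab`, `b₆ = −Σ abc`,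
  `b₈ = 3 abcd`; `pairValues_sum_eq_zero`, `pairValues_sum_mul_eq_zero`, `pairValues_prod_eq_Δ` —
  `B₁ + B₂ + B₃ = 0`, `B₁B₂ + B₁B₃ + B₂B₃ = 0`, `B₁B₂B₃ = Δ` (the pair values are the three roots of
  `X³ − Δ`, Euler's resolvent cubic of `Ψ₃/3`); `cubeRoots_of_sum_eq_zero` — hence `Bᵢ ≠ 0`,
  `Bᵢ³ = Δ`, `B₁² = B₂B₃`, pairwise distinct, `ω := B₂/B₁` has `ω² + ω + 1 = 0`, `B₃ = ω² B₁`.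

These identities drive files F2 (the CUBE-ROOT WEIL PAIRING `e(S,T) := B₂/B₁` on `E[3]`, an
explicit witness of the tree's existential `WeierstrassCurve.exists_weilPairing W 3`) and F3 (the
Δ-CUBE LAW of `3`-congruences).  Elementary algebra; nothing is cited as an input (context: the
resolvent for the RADICAL abscissae is in the tree as `ThreeTorsionRadicalsProofs.pair_mul_add_pair_mul_eq`
(`_one`, `_two`: `(12x₁)(12x₂) + (12x₃)(12x₄) = 48(b₄ − ζᵏ∛Δ)`) and is read in
`GaloisImage/ThreeTorsionCubeRootDelta` / `GaloisImage/ThreeTorsionCubeDiscriminant` (`Δ ∉ K³ ⇒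
3 ∣ [K(E[3]):K]`) — a different parametrisation; here Vieta on an ARBITRARY basis, which is what
the pairing needs; Serre 1972 §5.3; *AEC* Ex. 3.7).
-/

noncomputable section

open scoped Classical

open Polynomial WeierstrassCurve WeierstrassCurve.Affine.Point Literature.NumberTheory.EllipticCurves

namespace Summit.BirchSwinnertonDyer.Rank1Residual.GaloisImage.CubeRootPairing

universe u

/-! ### §1. Small facts about elements killed by `3` -/

section Group

variable {G : Type*} [AddCommGroup G]

/-- In a group, `3P = 0` gives `P + P = −P`. [folklore] -/
theorem add_self_eq_neg_of_three_smul {P : G} (h : (3 : ℤ) • P = 0) : P + P = -P := by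
  rw [← sub_eq_zero, sub_neg_eq_add]
  have : (3 : ℤ) • P = P + P + P := by
    rw [show (3 : ℤ) = 1 + 1 + 1 by norm_num, add_zsmul, add_zsmul, one_zsmul]
  rw [← this, h]

/-- In a group, `3P = 0` and `P + P = 0` give `P = 0`. [folklore] -/
theorem eq_zero_of_three_smul_of_add_self {P : G} (h : (3 : ℤ) • P = 0) (h2 : P + P = 0) :
    P = 0 := by
  have := add_self_eq_neg_of_three_smul h
  rw [h2, eq_comm, neg_eq_zero] at this
  exact this

/-- In a group, a non-zero `P` with `3P = 0` is not its own negative. [folklore] -/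
theorem ne_neg_self_of_three_smul {P : G} (h : (3 : ℤ) • P = 0) (h0 : P ≠ 0) : P ≠ -P := by
  intro hP
  apply h0
  apply eq_zero_of_three_smul_of_add_self h
  nth_rw 2 [hP]
  exact add_neg_cancel P

/-- `3(S + T) = 0` when `3S = 3T = 0`. [folklore] -/
theorem three_smul_add {S T : G} (hS : (3 : ℤ) • S = 0) (hT : (3 : ℤ) • T = 0) :
    (3 : ℤ) • (S + T) = 0 := by rw [zsmul_add, hS, hT, add_zero]

/-- `3(S − T) = 0` when `3S = 3T = 0`. [folklore] -/
theorem three_smul_sub {S T : G} (hS : (3 : ℤ) • S = 0) (hT : (3 : ℤ) • T = 0) :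
    (3 : ℤ) • (S - T) = 0 := by rw [zsmul_sub, hS, hT, sub_zero]

end Group
/-! ### §2. Abscissae of points of order `3` -/

section Points

variable {F : Type u} [Field F] (W : WeierstrassCurve F)

/-- **A point of order `3` is a root of `Ψ₃`**: if `3P = O`, `P ≠ O`, then `Ψ₃(x(P)) = 0` (any
model; `P` is not `2`-torsion, so *AEC* Exercise 3.7 applies — tree `three_smul_some_eq_zero_iff`).
[cite: SilvermanAEC2009, Exercise 3.7 (d)] -/
theorem eval_Ψ₃_xOf_eq_zero {P : W.toAffine.Point} (h3 : (3 : ℤ) • P = 0) (h0 : P ≠ 0) :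
    W.Ψ₃.eval (xOf P) = 0 := by
  rcases P with _ | ⟨x, y, h⟩
  · exact absurd Affine.Point.zero_def.symm h0
  · have hy : y ≠ W.toAffine.negY x y := by
      intro hy
      apply ne_neg_self_of_three_smul h3 h0
      rw [Affine.Point.neg_some]
      simp only [Affine.Point.some.injEq, true_and]
      exact hy
    have := (W.three_smul_some_eq_zero_iff h hy).mp h3
    rwa [ψ_three, Polynomial.evalEval_C] at this

/-- **Two affine points with the same abscissa are equal or opposite.**
[cite: SilvermanAEC2009, III.2.3] -/
theorem eq_or_eq_neg_of_xOf_eq {P Q : W.toAffine.Point} (hP : P ≠ 0) (hQ : Q ≠ 0)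
    (h : xOf P = xOf Q) : Q = P ∨ Q = -P := by
  rcases P with _ | ⟨x₁, y₁, h₁⟩
  · exact absurd Affine.Point.zero_def.symm hP
  rcases Q with _ | ⟨x₂, y₂, h₂⟩
  · exact absurd Affine.Point.zero_def.symm hQ
  simp only [xOf_some] at h
  subst h
  rcases Affine.Y_eq_of_X_eq h₂.left h₁.left rfl with hy | hy
  · left; subst hy; rfl
  · right
    rw [Affine.Point.neg_some]
    simp only [Affine.Point.some.injEq, true_and]
    exact hy

variable {W}

/-- **The four abscissae of a basis are pairwise distinct.** For `3S = 3T = 0` with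
`S, T, S + T, S − T ≠ O`, the abscissae `a, b, c, d` of `S, T, S + T, S − T` satisfy
`a ≠ b`, `a ≠ c`, `a ≠ d`, `b ≠ c`, `b ≠ d`, `c ≠ d` (equal abscissae would make two of the four
cyclic subgroups coincide). [folklore] -/
theorem xOf_ne_of_basis {S T : W.toAffine.Point} (hS : (3 : ℤ) • S = 0) (hT : (3 : ℤ) • T = 0)
    (h₁ : S ≠ 0) (h₂ : T ≠ 0) (h₃ : S + T ≠ 0) (h₄ : S - T ≠ 0) :
    xOf S ≠ xOf T ∧ xOf S ≠ xOf (S + T) ∧ xOf S ≠ xOf (S - T) ∧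
      xOf T ≠ xOf (S + T) ∧ xOf T ≠ xOf (S - T) ∧ xOf (S + T) ≠ xOf (S - T) := by
  have hSS := add_self_eq_neg_of_three_smul hS
  have hTT := add_self_eq_neg_of_three_smul hT
  refine ⟨fun h => ?_, fun h => ?_, fun h => ?_, fun h => ?_, fun h => ?_, fun h => ?_⟩
  · rcases eq_or_eq_neg_of_xOf_eq W h₁ h₂ h with e | e
    · exact h₄ (by rw [e, sub_self])
    · exact h₃ (by rw [e, add_neg_cancel])
  · rcases eq_or_eq_neg_of_xOf_eq W h₁ h₃ h with e | e
    · exact h₂ (by simpa using e)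
    · -- `S + T = -S` ⇒ `T = -S - S = S` ⇒ `S - T = 0`
      have hT' : T = S := by
        have e' : T = -S - S := by rw [eq_sub_iff_add_eq, add_comm]; exact e
        rw [e', sub_eq_add_neg, ← neg_add, hSS, neg_neg]
      exact h₄ (by rw [hT', sub_self])
  · rcases eq_or_eq_neg_of_xOf_eq W h₁ h₄ h with e | e
    · exact h₂ (by simpa using e)
    · -- `S - T = -S` ⇒ `T = S + S = -S` ⇒ `S + T = 0`
      have hT' : T = -S := by
        have e' : T = S + S := by
          rw [sub_eq_iff_eq_add] at e
          have := e; rw [neg_add_eq_sub, eq_sub_iff_add_eq] at this; exact this.symm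
        rw [e', hSS]
      exact h₃ (by rw [hT', add_neg_cancel])
  · rcases eq_or_eq_neg_of_xOf_eq W h₂ h₃ h with e | e
    · exact h₁ (by simpa using e)
    · -- `S + T = -T` ⇒ `S = -T - T = T` ⇒ `S - T = 0`
      have hS' : S = T := by
        have e' : S = -T - T := by rw [eq_sub_iff_add_eq]; exact e
        rw [e', sub_eq_add_neg, ← neg_add, hTT, neg_neg]
      exact h₄ (by rw [hS', sub_self])
  · rcases eq_or_eq_neg_of_xOf_eq W h₂ h₄ h with e | e
    · -- `S - T = T` ⇒ `S = T + T = -T` ⇒ `S + T = 0`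
      have hS' : S = -T := by
        have e' : S = T + T := by rw [sub_eq_iff_eq_add] at e; exact e
        rw [e', hTT]
      exact h₃ (by rw [hS', neg_add_cancel])
    · -- `S - T = -T` ⇒ `S = 0`
      exact h₁ (by simpa using e)
  · rcases eq_or_eq_neg_of_xOf_eq W h₃ h₄ h with e | e
    · -- `S - T = S + T` ⇒ `T + T = 0` ⇒ `T = 0`
      apply h₂ (eq_zero_of_three_smul_of_add_self hT ?_)
      have : S + T - (S - T) = 0 := by rw [e, sub_self]
      rw [← this]; abel
    · -- `S - T = -(S + T)` ⇒ `S + S = 0` ⇒ `S = 0`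
      apply h₁ (eq_zero_of_three_smul_of_add_self hS ?_)
      have : S - T + (S + T) = 0 := by rw [e, neg_add_cancel]
      rw [← this]; abel

end Points

/-! ### §3. Vieta on a basis -/

section Vieta

variable {F : Type u} [Field F] [CharZero F] {W : WeierstrassCurve F}

omit [CharZero F] in
/-- Coefficient comparison for quartics written in the normal form `Σ C pₖ X^k`. [folklore] -/
private theorem coeffs_eq_of_quartic_eq {p₀ p₁ p₂ p₃ p₄ q₀ q₁ q₂ q₃ q₄ : F}
    (h : C p₄ * X ^ 4 + C p₃ * X ^ 3 + C p₂ * X ^ 2 + C p₁ * X + C p₀ =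
      C q₄ * X ^ 4 + C q₃ * X ^ 3 + C q₂ * X ^ 2 + C q₁ * X + C q₀) :
    p₀ = q₀ ∧ p₁ = q₁ ∧ p₂ = q₂ ∧ p₃ = q₃ := by
  have hk : ∀ k, (C p₄ * X ^ 4 + C p₃ * X ^ 3 + C p₂ * X ^ 2 + C p₁ * X + C p₀).coeff k =
      (C q₄ * X ^ 4 + C q₃ * X ^ 3 + C q₂ * X ^ 2 + C q₁ * X + C q₀).coeff k := fun k => by
    rw [h]
  have h0 := hk 0
  have h1 := hk 1
  have h2 := hk 2
  have h3 := hk 3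
  simp only [coeff_add, coeff_C_mul, coeff_X_pow, coeff_X, coeff_C] at h0 h1 h2 h3
  norm_num at h0 h1 h2 h3
  exact ⟨h0, h1, h2, h3⟩

/-- **`Ψ₃ = 3(X − a)(X − b)(X − c)(X − d)` on a basis.** For `3S = 3T = 0` with
`S, T, S + T, S − T ≠ O` and `a, b, c, d` their abscissae, the `3`-division polynomial factors
through the four distinct roots. [cite: SilvermanAEC2009, Exercise 3.7 (d)] -/
theorem Ψ₃_eq_prod_of_basis [W.IsElliptic] {S T : W.toAffine.Point} (hS : (3 : ℤ) • S = 0)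
    (hT : (3 : ℤ) • T = 0) (h₁ : S ≠ 0) (h₂ : T ≠ 0) (h₃ : S + T ≠ 0) (h₄ : S - T ≠ 0) :
    W.Ψ₃ = C 3 * ((X - C (xOf S)) * ((X - C (xOf T)) *
      ((X - C (xOf (S + T))) * (X - C (xOf (S - T)))))) := by
  set a := xOf S
  set b := xOf T
  set c := xOf (S + T)
  set d := xOf (S - T)
  have h3F : (3 : F) ≠ 0 := by norm_num
  obtain ⟨hab, hac, had, hbc, hbd, hcd⟩ := xOf_ne_of_basis hS hT h₁ h₂ h₃ h₄
  have hp0 : W.Ψ₃ ≠ 0 := W.Ψ₃_ne_zero h3F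
  have hdeg : W.Ψ₃.natDegree = 4 := W.natDegree_Ψ₃ h3F
  have hlc : W.Ψ₃.leadingCoeff = 3 := W.leadingCoeff_Ψ₃ h3F
  -- the four roots
  have ra : W.Ψ₃.eval a = 0 := eval_Ψ₃_xOf_eq_zero W hS h₁
  have rb : W.Ψ₃.eval b = 0 := eval_Ψ₃_xOf_eq_zero W hT h₂
  have rc : W.Ψ₃.eval c = 0 := eval_Ψ₃_xOf_eq_zero W (three_smul_add hS hT) h₃
  have rd : W.Ψ₃.eval d = 0 := eval_Ψ₃_xOf_eq_zero W (three_smul_sub hS hT) h₄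
  -- the multiset `{a, b, c, d}` is the multiset of roots
  set m : Multiset F := a ::ₘ b ::ₘ c ::ₘ d ::ₘ 0 with hm
  have hnodup : m.Nodup := by
    simp only [hm, Multiset.nodup_cons, Multiset.mem_cons, Multiset.notMem_zero, or_false,
      not_or, Multiset.nodup_zero, and_true, not_false_eq_true]
    exact ⟨⟨hab, hac, had⟩, ⟨hbc, hbd⟩, hcd⟩
  have hsub : m ⊆ W.Ψ₃.roots := by
    intro x hx
    simp only [hm, Multiset.mem_cons, Multiset.notMem_zero, or_false] at hx
    rw [mem_roots hp0, IsRoot.def]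
    rcases hx with rfl | rfl | rfl | rfl
    exacts [ra, rb, rc, rd]
  have hle : m ≤ W.Ψ₃.roots := (Multiset.le_iff_subset hnodup).mpr hsub
  have hcard : Multiset.card m = 4 := by simp [hm]
  have hroots : W.Ψ₃.roots = m := by
    refine (Multiset.eq_of_le_of_card_le hle ?_).symm
    rw [hcard, ← hdeg]
    exact card_roots' _
  have hcr : Multiset.card W.Ψ₃.roots = W.Ψ₃.natDegree := by rw [hroots, hcard, hdeg]
  have key := C_leadingCoeff_mul_prod_multiset_X_sub_C hcr
  rw [hlc, hroots] at key
  rw [← key]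
  simp only [hm, Multiset.map_cons, Multiset.map_zero, Multiset.prod_cons, Multiset.prod_zero,
    mul_one]

/-- **Vieta for the `3`-division polynomial on a basis**: with `a, b, c, d` the abscissae of
`S, T, S + T, S − T`, `b₂ = −3(a + b + c + d)`, `b₄ = Σ ab`, `b₆ = −Σ abc`, `b₈ = 3abcd`
(compare `Ψ₃ = 3X⁴ + b₂X³ + 3b₄X² + 3b₆X + b₈` with `3∏(X − ·)`).
[cite: SilvermanAEC2009, Exercise 3.7 (b)] -/
theorem vieta_of_basis [W.IsElliptic] {S T : W.toAffine.Point} (hS : (3 : ℤ) • S = 0)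
    (hT : (3 : ℤ) • T = 0) (h₁ : S ≠ 0) (h₂ : T ≠ 0) (h₃ : S + T ≠ 0) (h₄ : S - T ≠ 0) :
    W.b₂ = -3 * (xOf S + xOf T + xOf (S + T) + xOf (S - T)) ∧
    W.b₄ = xOf S * xOf T + xOf S * xOf (S + T) + xOf S * xOf (S - T) +
      xOf T * xOf (S + T) + xOf T * xOf (S - T) + xOf (S + T) * xOf (S - T) ∧
    W.b₆ = -(xOf S * xOf T * xOf (S + T) + xOf S * xOf T * xOf (S - T) +
      xOf S * xOf (S + T) * xOf (S - T) + xOf T * xOf (S + T) * xOf (S - T)) ∧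
    W.b₈ = 3 * (xOf S * xOf T * xOf (S + T) * xOf (S - T)) := by
  set a := xOf S
  set b := xOf T
  set c := xOf (S + T)
  set d := xOf (S - T)
  have hΨ := Ψ₃_eq_prod_of_basis hS hT h₁ h₂ h₃ h₄
  have hL : W.Ψ₃ = C 3 * X ^ 4 + C W.b₂ * X ^ 3 + C (3 * W.b₄) * X ^ 2 + C (3 * W.b₆) * X +
      C W.b₈ := by
    rw [WeierstrassCurve.Ψ₃]; simp only [map_mul, map_ofNat]
  have hR : C 3 * ((X - C a) * ((X - C b) * ((X - C c) * (X - C d)))) =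
      C 3 * X ^ 4 + C (-3 * (a + b + c + d)) * X ^ 3 +
      C (3 * (a * b + a * c + a * d + b * c + b * d + c * d)) * X ^ 2 +
      C (-3 * (a * b * c + a * b * d + a * c * d + b * c * d)) * X + C (3 * (a * b * c * d)) := by
    simp only [map_mul, map_add, map_neg, map_ofNat]; ring
  rw [hL, hR] at hΨ
  obtain ⟨e0, e1, e2, e3⟩ := coeffs_eq_of_quartic_eq hΨ
  refine ⟨e3, ?_, ?_, e0⟩
  · have h3F : (3 : F) ≠ 0 := by norm_num
    exact mul_left_cancel₀ h3F (by rw [e2])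
  · have h3F : (3 : F) ≠ 0 := by norm_num
    exact mul_left_cancel₀ h3F (by rw [e1]; ring)

/-- The ROOT RELATION of a basis: `12abcd = 3(Σa)(Σabc) − (Σab)²` — Mathlib's `b_relation`
`4b₈ = b₂b₆ − b₄²` read through Vieta. [folklore] -/
theorem root_relation_of_basis [W.IsElliptic] {S T : W.toAffine.Point} (hS : (3 : ℤ) • S = 0)
    (hT : (3 : ℤ) • T = 0) (h₁ : S ≠ 0) (h₂ : T ≠ 0) (h₃ : S + T ≠ 0) (h₄ : S - T ≠ 0) :
    12 * (xOf S * xOf T * xOf (S + T) * xOf (S - T)) =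
      3 * (xOf S + xOf T + xOf (S + T) + xOf (S - T)) *
        (xOf S * xOf T * xOf (S + T) + xOf S * xOf T * xOf (S - T) +
          xOf S * xOf (S + T) * xOf (S - T) + xOf T * xOf (S + T) * xOf (S - T)) -
      (xOf S * xOf T + xOf S * xOf (S + T) + xOf S * xOf (S - T) +
        xOf T * xOf (S + T) + xOf T * xOf (S - T) + xOf (S + T) * xOf (S - T)) ^ 2 := by
  obtain ⟨e1, e2, e3, e4⟩ := vieta_of_basis hS hT h₁ h₂ h₃ h₄
  have hb := W.b_relation
  rw [e1, e2, e3, e4] at hb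
  linear_combination hb

/-- **The pair values sum to zero**: `B₁ + B₂ + B₃ = 0`. [folklore] -/
theorem pairValues_sum_eq_zero [W.IsElliptic] {S T : W.toAffine.Point} (hS : (3 : ℤ) • S = 0)
    (hT : (3 : ℤ) • T = 0) (h₁ : S ≠ 0) (h₂ : T ≠ 0) (h₃ : S + T ≠ 0) (h₄ : S - T ≠ 0) :
    (W.b₄ - 3 * (xOf S * xOf T + xOf (S + T) * xOf (S - T))) +
      (W.b₄ - 3 * (xOf S * xOf (S + T) + xOf T * xOf (S - T))) +
      (W.b₄ - 3 * (xOf S * xOf (S - T) + xOf T * xOf (S + T))) = 0 := by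
  obtain ⟨-, e2, -, -⟩ := vieta_of_basis hS hT h₁ h₂ h₃ h₄
  linear_combination 3 * e2

/-- **The pairwise products of the pair values sum to zero**: `B₁B₂ + B₁B₃ + B₂B₃ = 0`
(Vieta + the root relation). [folklore] -/
theorem pairValues_sum_mul_eq_zero [W.IsElliptic] {S T : W.toAffine.Point} (hS : (3 : ℤ) • S = 0)
    (hT : (3 : ℤ) • T = 0) (h₁ : S ≠ 0) (h₂ : T ≠ 0) (h₃ : S + T ≠ 0) (h₄ : S - T ≠ 0) :
    (W.b₄ - 3 * (xOf S * xOf T + xOf (S + T) * xOf (S - T))) *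
        (W.b₄ - 3 * (xOf S * xOf (S + T) + xOf T * xOf (S - T))) +
      (W.b₄ - 3 * (xOf S * xOf T + xOf (S + T) * xOf (S - T))) *
        (W.b₄ - 3 * (xOf S * xOf (S - T) + xOf T * xOf (S + T))) +
      (W.b₄ - 3 * (xOf S * xOf (S + T) + xOf T * xOf (S - T))) *
        (W.b₄ - 3 * (xOf S * xOf (S - T) + xOf T * xOf (S + T))) = 0 := by
  obtain ⟨-, e2, -, -⟩ := vieta_of_basis hS hT h₁ h₂ h₃ h₄
  have hr := root_relation_of_basis hS hT h₁ h₂ h₃ h₄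
  rw [e2]
  linear_combination (-3) * hr

/-- **The product of the pair values is the discriminant**: `B₁B₂B₃ = Δ`. [folklore] -/
theorem pairValues_prod_eq_Δ [W.IsElliptic] {S T : W.toAffine.Point} (hS : (3 : ℤ) • S = 0)
    (hT : (3 : ℤ) • T = 0) (h₁ : S ≠ 0) (h₂ : T ≠ 0) (h₃ : S + T ≠ 0) (h₄ : S - T ≠ 0) :
    (W.b₄ - 3 * (xOf S * xOf T + xOf (S + T) * xOf (S - T))) *
        (W.b₄ - 3 * (xOf S * xOf (S + T) + xOf T * xOf (S - T))) *
        (W.b₄ - 3 * (xOf S * xOf (S - T) + xOf T * xOf (S + T))) = W.Δ := by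
  obtain ⟨e1, e2, e3, e4⟩ := vieta_of_basis hS hT h₁ h₂ h₃ h₄
  have hr := root_relation_of_basis hS hT h₁ h₂ h₃ h₄
  rw [WeierstrassCurve.Δ, e1, e2, e3, e4]
  linear_combination (6 * (xOf S * xOf T + xOf S * xOf (S + T) + xOf S * xOf (S - T) +
      xOf T * xOf (S + T) + xOf T * xOf (S - T) + xOf (S + T) * xOf (S - T))) * hr

end Vieta

/-! ### §4. Consequences: the pair values are the three cube roots of `Δ` -/
section CubeRoots

variable {F : Type u} [Field F]

/-- Three numbers with `Σ = 0`, `Σ BᵢBⱼ = 0`, `∏ = Δ ≠ 0`: each is `≠ 0` and cubes to `Δ`,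
`B₁² = B₂B₃`, they are distinct, and `B₂/B₁` is a primitive cube root of unity. [folklore] -/
theorem cubeRoots_of_sum_eq_zero [CharZero F] {B₁ B₂ B₃ Δ : F} (h1 : B₁ + B₂ + B₃ = 0)
    (h2 : B₁ * B₂ + B₁ * B₃ + B₂ * B₃ = 0) (h3 : B₁ * B₂ * B₃ = Δ) (hΔ : Δ ≠ 0) :
    B₁ ≠ 0 ∧ B₂ ≠ 0 ∧ B₃ ≠ 0 ∧ B₁ ^ 3 = Δ ∧ B₂ ^ 3 = Δ ∧ B₃ ^ 3 = Δ ∧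
      B₁ ^ 2 = B₂ * B₃ ∧ B₂ ^ 2 = B₁ * B₃ ∧ B₃ ^ 2 = B₁ * B₂ ∧
      B₁ ≠ B₂ ∧ B₁ ≠ B₃ ∧ B₂ ≠ B₃ ∧
      (B₂ / B₁) ^ 2 + B₂ / B₁ + 1 = 0 ∧ (B₂ / B₁) ^ 3 = 1 ∧ B₂ / B₁ ≠ 1 ∧
      B₃ / B₁ = (B₂ / B₁) ^ 2 := by
  have hB₁ : B₁ ≠ 0 := fun h => hΔ (by rw [← h3, h, zero_mul, zero_mul])
  have hB₂ : B₂ ≠ 0 := fun h => hΔ (by rw [← h3, h, mul_zero, zero_mul])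
  have hB₃ : B₃ ≠ 0 := fun h => hΔ (by rw [← h3, h, mul_zero])
  have s1 : B₁ ^ 2 = B₂ * B₃ := by linear_combination B₁ * h1 - h2
  have s2 : B₂ ^ 2 = B₁ * B₃ := by linear_combination B₂ * h1 - h2
  have s3 : B₃ ^ 2 = B₁ * B₂ := by linear_combination B₃ * h1 - h2
  have c1 : B₁ ^ 3 = Δ := by linear_combination B₁ * s1 + h3
  have c2 : B₂ ^ 3 = Δ := by linear_combination B₂ * s2 + h3
  have c3 : B₃ ^ 3 = Δ := by linear_combination B₃ * s3 + h3
  have d12 : B₁ ≠ B₂ := by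
    intro h
    have : (3 : F) * B₁ ^ 2 = 0 := by linear_combination (B₁ + B₂) * h1 - h2 + (2 * B₁ + B₂) * h
    exact hB₁ (pow_eq_zero_iff (n := 2) (by norm_num) |>.mp
      ((mul_eq_zero.mp this).resolve_left (by norm_num)))
  have d13 : B₁ ≠ B₃ := by
    intro h
    have : (3 : F) * B₁ ^ 2 = 0 := by linear_combination (B₁ + B₃) * h1 - h2 + (2 * B₁ + B₃) * h
    exact hB₁ (pow_eq_zero_iff (n := 2) (by norm_num) |>.mp
      ((mul_eq_zero.mp this).resolve_left (by norm_num)))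
  have d23 : B₂ ≠ B₃ := by
    intro h
    have : (3 : F) * B₂ ^ 2 = 0 := by linear_combination (B₂ + B₃) * h1 - h2 + (2 * B₂ + B₃) * h
    exact hB₂ (pow_eq_zero_iff (n := 2) (by norm_num) |>.mp
      ((mul_eq_zero.mp this).resolve_left (by norm_num)))
  have key : B₁ ^ 2 + B₁ * B₂ + B₂ ^ 2 = 0 := by linear_combination (B₁ + B₂) * h1 - h2
  have w1 : (B₂ / B₁) ^ 2 + B₂ / B₁ + 1 = 0 := by
    field_simp
    linear_combination key
  have w2 : (B₂ / B₁) ^ 3 = 1 := by rw [div_pow, c2, c1, div_self hΔ]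
  have w3 : B₂ / B₁ ≠ 1 := fun h => d12 (by rw [div_eq_one_iff_eq hB₁] at h; exact h.symm)
  have w4 : B₃ / B₁ = (B₂ / B₁) ^ 2 := by
    rw [div_pow, s2]
    field_simp
  exact ⟨hB₁, hB₂, hB₃, c1, c2, c3, s1, s2, s3, d12, d13, d23, w1, w2, w3, w4⟩

end CubeRoots

end Summit.BirchSwinnertonDyer.Rank1Residual.GaloisImage.CubeRootPairing

end
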